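import Mathlib
import Literature.Probability.LatticeModels.ProdBernoulliIndependence
import Literature.Probability.Percolation.ConditionalPositiveAssociation
import Literature.Probability.Percolation.ConditionalPositiveAssociationProofs
import Literature.Probability.Percolation.TwoClusterConditionalAssociation
import Literature.Probability.Percolation.PercolationProofs
import Literature.Probability.Percolation.SharpnessDCTProofs
import Summits.CriticalPhenomena.PercolationContinuityZ3.Theorems.PercNearOneGluingAdditiveGluingGoodPocketMarkov
import HarnessLib

/-!
# Crux `PercNearOneGluing.AdditiveGluing` (stmt-CriticalPhenomena-4576), line `subuniform-dead-pocket-maximum`,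
# stub `stub_goodStep` — fibres of the cluster map and BHK Thm 1.3 in finite-sum form (siege k28, file 1/3)

Helper file for the crux (siege seat k28 on the hardest stub `stub_goodStep` of the skeleton
`Cruxes/AdditiveGluing/Lines/subuniform-dead-pocket-maximum.lean`); tooling for the theorem
`knLemma3i_offObserver` (Kozma–Nitzan Lemma 3(i) under the order of `G ∖ o`, file 3/3).  Lands with
`--supports stmt-CriticalPhenomena-4576`; no definitions.

Notation: `μ = prodBernoulli w` on the bond configurations of the complete weighted graph `Fin n`; `C(s)` the open
(vertex) cluster `openCluster · s`; its fibres `{C(s) = T}` (`T : Finset (Fin n)`); `C_s` the open EDGE cluster of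
van den Berg–Häggström–Kahn (`openEdgeCluster`).

## Content
* `offObs_setIntegral_clusterFn`: `∫_D φ(C(s)) dμ = Σ_T φ(T) μ(D ∩ {C(s) = T})` (finite-sum form of an integral of a
  function of the vertex cluster), and `offObs_vertF_openEdgeCluster`: the vertex set of `C_s` is `C(s)`;
* `offObs_fibre_inter`: the **Markov property of the cluster** — on `{C(s) = T}` the pairs avoiding `T` keep their
  product law: `μ({C(s) = T} ∩ E) = μ(C(s) = T) μ(E)` for `E` determined by the pairs inside `Tᶜ`;
* `offObs_bhk_mono_anti` / `offObs_bhk_anti_anti`: van den Berg–Häggström–Kahn 2006 Thm 1.3 (tree: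
  `BHK2006_clusterConditionalPositiveAssociation_holds`) for set functions `φ, ψ` of the VERTEX cluster, as
  inequalities between the finite sums `Σ_T φ(T)ψ(T) μ(D ∩ {C(s)=T})`, `D = {s ↮ X}`.
-/

namespace Summit.CriticalPhenomena.PercolationContinuityZ3.Theorems

open MeasureTheory Set
open Literature.Probability.LatticeModels (prodBernoulli)
open Literature.Probability.Percolation

noncomputable section
open Classical
open scoped BigOperators

section OffObserverFibres

open Literature.Probability.LatticeModels Literature.Probability.Percolation

variable {n : ℕ}

/-! ### The vertex set of a set of pairs; the cluster as a `Finset`; fibres -/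

/-- The vertex set `V_s(C) = {s} ∪ ⋃ C` of a set of pairs is monotone in `C`. [folklore] -/
theorem offObs_vertF_mono (s : Fin n) :
    Monotone fun C : Set (Sym2 (Fin n)) => Finset.univ.filter fun v : Fin n => v = s ∨ ∃ e ∈ C, v ∈ e := by
  intro C C' h v hv
  simp only [Finset.mem_filter, Finset.mem_univ, true_and] at hv ⊢
  rcases hv with hv | ⟨e, he, hve⟩
  · exact Or.inl hv
  · exact Or.inr ⟨e, h he, hve⟩

/-- `V_s(C_s(ω)) = C(s)`: a vertex is joined to `s` iff it is `s` or lies on an edge of the open edge cluster.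
[cite: VandenbergHaggstromKahn2005, §1 p. 3] -/
theorem offObs_vertF_openEdgeCluster (s : Fin n) (ω : BondConfig (Fin n)) :
    (Finset.univ.filter fun v : Fin n => v = s ∨ ∃ e ∈ openEdgeCluster ω s, v ∈ e) =
      Finset.univ.filter fun v : Fin n => v ∈ openCluster ω s := by
  ext v
  simp only [Finset.mem_filter, Finset.mem_univ, true_and]
  rw [show (v ∈ openCluster ω s ↔ (openGraph ω).Reachable s v) from Iff.rfl,
    reachable_iff_exists_mem_openEdgeCluster ω s v]

/-- The cluster `Finset` coerces back to the cluster. [folklore] -/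
theorem offObs_coe_clF (s : Fin n) (ω : BondConfig (Fin n)) :
    ((Finset.univ.filter fun v : Fin n => v ∈ openCluster ω s : Finset (Fin n)) : Set (Fin n)) =
      openCluster ω s := by
  ext v; simp

/-- Membership in a fibre `{C(s) = T}` in terms of the cluster `Finset`. [folklore] -/
theorem offObs_mem_fib_iff (s : Fin n) (T : Finset (Fin n)) (ω : BondConfig (Fin n)) :
    ω ∈ {ω : BondConfig (Fin n) | openCluster ω s = (T : Set (Fin n))} ↔
      (Finset.univ.filter fun v : Fin n => v ∈ openCluster ω s) = T := by
  simp only [Set.mem_setOf_eq]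
  constructor
  · intro h
    ext v
    simp only [Finset.mem_filter, Finset.mem_univ, true_and]
    rw [h]; exact Finset.mem_coe
  · intro h
    rw [← h, offObs_coe_clF]

/-- **Finite-sum form of an integral of a function of the cluster**:
`∫_D φ(C(s)) dμ = Σ_T φ(T) μ(D ∩ {C(s) = T})`. [folklore] -/
theorem offObs_setIntegral_clusterFn (w : Sym2 (Fin n) → unitInterval) (s : Fin n)
    (φ : Finset (Fin n) → ℝ) (D : Set (BondConfig (Fin n))) :
    ∫ ω in D, φ (Finset.univ.filter fun v : Fin n => v ∈ openCluster ω s) ∂(prodBernoulli w) =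
      ∑ T : Finset (Fin n), φ T *
        (prodBernoulli w).real (D ∩ {ω : BondConfig (Fin n) | openCluster ω s = (T : Set (Fin n))}) := by
  have hpt : ∀ ω : BondConfig (Fin n), φ (Finset.univ.filter fun v : Fin n => v ∈ openCluster ω s) =
      ∑ T : Finset (Fin n),
        ({ω : BondConfig (Fin n) | openCluster ω s = (T : Set (Fin n))}).indicator (fun _ => φ T) ω := by
    intro ω
    rw [Finset.sum_eq_single (Finset.univ.filter fun v : Fin n => v ∈ openCluster ω s)]
    · rw [Set.indicator_of_mem ((offObs_mem_fib_iff s _ ω).2 rfl)]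
    · intro T _ hT
      rw [Set.indicator_of_notMem]
      exact fun h => hT ((offObs_mem_fib_iff s T ω).1 h).symm
    · exact fun h => absurd (Finset.mem_univ _) h
  simp_rw [hpt]
  rw [integral_finsetSum]
  · refine Finset.sum_congr rfl fun T _ => ?_
    rw [setIntegral_indicator MeasurableSet.of_discrete, setIntegral_const, smul_eq_mul, mul_comm]
  · intro T _
    exact (integrable_const _).indicator MeasurableSet.of_discrete

/-- The fibres of the cluster map partition any event: `Σ_T μ({C(s) = T} ∩ F) = μ(F)`. [folklore] -/
theorem offObs_sum_fib_inter (w : Sym2 (Fin n) → unitInterval) (s : Fin n) (F : Set (BondConfig (Fin n))) :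
    ∑ T : Finset (Fin n), (prodBernoulli w).real ({ω : BondConfig (Fin n) | openCluster ω s = (T : Set (Fin n))} ∩ F) =
      (prodBernoulli w).real F := by
  have h := sigmaRec_sum_preimage_inter w (fun ω => Finset.univ.filter fun v : Fin n => v ∈ openCluster ω s) F
  refine Eq.trans (Finset.sum_congr rfl fun T _ => ?_) h
  congr 1
  ext ω
  simp only [Set.mem_inter_iff, Set.mem_preimage, Set.mem_singleton_iff, offObs_mem_fib_iff]

/-! ### The Markov property of the cluster -/

/-- A connection inside `Tᶜ` is determined by the pairs avoiding `T`. [folklore] -/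
theorem offObs_determinedBy_openConnIn_compl (T : Finset (Fin n)) (x y : Fin n) :
    DeterminedBy (openConnIn ((T : Set (Fin n))ᶜ) x y)
      (↑(Finset.univ.filter fun e : Sym2 (Fin n) => ∀ v ∈ e, v ∉ T) : Set (Sym2 (Fin n))) := by
  refine DCT16.determinedBy_openConnIn ((T : Set (Fin n))ᶜ) x y fun e he => ?_
  rw [Finset.coe_filter]
  exact ⟨Finset.mem_univ _, fun v hv => Set.mem_sym2_iff_subset.1 he hv⟩

/-- **Cluster Markov property** (product measure): for `s ∈ T` and an event `E` determined by the pairs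
avoiding `T`, `μ({C(s) = T} ∩ E) = μ(C(s) = T) · μ(E)` (`{C(s) = T}` is determined by the pairs meeting `T`).
[folklore; cf. Kozma–Nitzan arXiv:2401.12397, proof of Thm 5 p. 14] -/
theorem offObs_fibre_inter (w : Sym2 (Fin n) → unitInterval) (s : Fin n) (T : Finset (Fin n)) (hs : s ∈ T)
    (E : Set (BondConfig (Fin n)))
    (hE : DeterminedBy E (↑(Finset.univ.filter fun e : Sym2 (Fin n) => ∀ v ∈ e, v ∉ T) : Set (Sym2 (Fin n)))) :
    (prodBernoulli w).real ({ω : BondConfig (Fin n) | openCluster ω s = (T : Set (Fin n))} ∩ E) =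
      (prodBernoulli w).real {ω : BondConfig (Fin n) | openCluster ω s = (T : Set (Fin n))} *
        (prodBernoulli w).real E := by
  refine prodBernoulli_real_inter_of_determinedBy_disjoint w
    (F := Finset.univ.filter fun e : Sym2 (Fin n) => ∃ x ∈ T, x ∈ e)
    (F' := Finset.univ.filter fun e : Sym2 (Fin n) => ∀ v ∈ e, v ∉ T) ?_
    (goodPM_determinedBy_cluster_eq s T hs) hE MeasurableSet.of_discrete MeasurableSet.of_discrete
  rw [Finset.disjoint_left]
  intro e he he'
  obtain ⟨x, hxT, hxe⟩ := (Finset.mem_filter.1 he).2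
  exact (Finset.mem_filter.1 he').2 x hxe hxT

/-! ### Elementary facts about the fibres -/

/-- A fibre `{C(s) = T}` with `s ∉ T` is empty. [folklore] -/
theorem offObs_fib_eq_empty (s : Fin n) (T : Finset (Fin n)) (hs : s ∉ T) :
    {ω : BondConfig (Fin n) | openCluster ω s = (T : Set (Fin n))} = ∅ := by
  ext ω
  simp only [Set.mem_setOf_eq, Set.mem_empty_iff_false, iff_false]
  intro h
  have : s ∈ openCluster ω s := mem_openCluster_self ω s
  rw [h] at this
  exact hs (Finset.mem_coe.1 this)

/-- On `{C(s) = T}`, every `x ∈ T` is joined to `s`. [folklore] -/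
theorem offObs_fib_subset_openConn (s x : Fin n) (T : Finset (Fin n)) (hx : x ∈ T) :
    {ω : BondConfig (Fin n) | openCluster ω s = (T : Set (Fin n))} ⊆ openConn s x := by
  intro ω hω
  have : x ∈ openCluster ω s := by
    rw [show openCluster ω s = (T : Set (Fin n)) from hω]; exact Finset.mem_coe.2 hx
  exact this

/-- On `{C(s) = T}`, no `x ∉ T` is joined to `s`. [folklore] -/
theorem offObs_fib_subset_compl_openConn (s x : Fin n) (T : Finset (Fin n)) (hx : x ∉ T) :
    {ω : BondConfig (Fin n) | openCluster ω s = (T : Set (Fin n))} ⊆ (openConn s x)ᶜ := by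
  intro ω hω hsx
  have : x ∈ openCluster ω s := hsx
  rw [show openCluster ω s = (T : Set (Fin n)) from hω] at this
  exact hx (Finset.mem_coe.1 this)

/-- On `{C(s) = T}` with `b ∈ T ∌ a`, the vertex `a` is not joined to `b`. [folklore] -/
theorem offObs_fib_inter_openConn_eq_empty (s a b : Fin n) (T : Finset (Fin n)) (hb : b ∈ T) (ha : a ∉ T) :
    {ω : BondConfig (Fin n) | openCluster ω s = (T : Set (Fin n))} ∩ openConn a b = ∅ := by
  ext ω
  simp only [Set.mem_inter_iff, Set.mem_empty_iff_false, iff_false, not_and]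
  intro hω hab
  have hsb : (openGraph ω).Reachable s b := offObs_fib_subset_openConn s b T hb hω
  have hsa : (openGraph ω).Reachable s a := hsb.trans (SimpleGraph.Reachable.symm hab)
  exact offObs_fib_subset_compl_openConn s a T ha hω hsa

/-! ### BHK Thm 1.3 for set functions of the vertex cluster, in finite-sum form -/

/-- **BHK Thm 1.3, increasing × antitone, finite-sum form**: for `s ∉ X`, `D = {s ↮ X}`, `φ` monotone and `ψ`
antitone set functions of the vertex cluster,
`μ(D) · Σ_T φ(T)ψ(T) μ(D ∩ {C(s)=T}) ≤ (Σ_T φ(T) μ(D ∩ {C(s)=T})) · (Σ_T ψ(T) μ(D ∩ {C(s)=T}))`.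
[cite: VandenbergHaggstromKahn2005, Thm. 1.3 (p. 6)] -/
theorem offObs_bhk_mono_anti (w : Sym2 (Fin n) → unitInterval) (s : Fin n) (X : Set (Fin n)) (hs : s ∉ X)
    (φ ψ : Finset (Fin n) → ℝ) (hφ : Monotone φ) (hψ : Antitone ψ) :
    (prodBernoulli w).real {ω : BondConfig (Fin n) | ∀ x ∈ X, ¬ (openGraph ω).Reachable s x} *
        ∑ T : Finset (Fin n), (φ T * ψ T) *
          (prodBernoulli w).real ({ω : BondConfig (Fin n) | ∀ x ∈ X, ¬ (openGraph ω).Reachable s x} ∩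
            {ω : BondConfig (Fin n) | openCluster ω s = (T : Set (Fin n))}) ≤
      (∑ T : Finset (Fin n), φ T *
          (prodBernoulli w).real ({ω : BondConfig (Fin n) | ∀ x ∈ X, ¬ (openGraph ω).Reachable s x} ∩
            {ω : BondConfig (Fin n) | openCluster ω s = (T : Set (Fin n))})) *
        ∑ T : Finset (Fin n), ψ T *
          (prodBernoulli w).real ({ω : BondConfig (Fin n) | ∀ x ∈ X, ¬ (openGraph ω).Reachable s x} ∩
            {ω : BondConfig (Fin n) | openCluster ω s = (T : Set (Fin n))}) := by
  have key := BHK2006_clusterConditionalPositiveAssociation_holds.antitone_right (Fin n) w s X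
    (fun C => φ (Finset.univ.filter fun v : Fin n => v = s ∨ ∃ e ∈ C, v ∈ e))
    (fun C => ψ (Finset.univ.filter fun v : Fin n => v = s ∨ ∃ e ∈ C, v ∈ e))
    (fun C C' h => hφ (offObs_vertF_mono s h)) (fun C C' h => hψ (offObs_vertF_mono s h)) hs
  simp only [offObs_vertF_openEdgeCluster] at key
  rw [offObs_setIntegral_clusterFn w s φ, offObs_setIntegral_clusterFn w s ψ,
    offObs_setIntegral_clusterFn w s (fun T => φ T * ψ T)] at key
  exact key

/-- **BHK Thm 1.3, antitone × antitone, finite-sum form**: for `s ∉ X`, `D = {s ↮ X}` and `φ, ψ` antitone,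
`(Σ_T φ(T) μ(D ∩ {C(s)=T})) · (Σ_T ψ(T) μ(D ∩ {C(s)=T})) ≤ μ(D) · Σ_T φ(T)ψ(T) μ(D ∩ {C(s)=T})`.
[cite: VandenbergHaggstromKahn2005, Thm. 1.3 (p. 6)] -/
theorem offObs_bhk_anti_anti (w : Sym2 (Fin n) → unitInterval) (s : Fin n) (X : Set (Fin n)) (hs : s ∉ X)
    (φ ψ : Finset (Fin n) → ℝ) (hφ : Antitone φ) (hψ : Antitone ψ) :
    (∑ T : Finset (Fin n), φ T *
          (prodBernoulli w).real ({ω : BondConfig (Fin n) | ∀ x ∈ X, ¬ (openGraph ω).Reachable s x} ∩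
            {ω : BondConfig (Fin n) | openCluster ω s = (T : Set (Fin n))})) *
        (∑ T : Finset (Fin n), ψ T *
          (prodBernoulli w).real ({ω : BondConfig (Fin n) | ∀ x ∈ X, ¬ (openGraph ω).Reachable s x} ∩
            {ω : BondConfig (Fin n) | openCluster ω s = (T : Set (Fin n))})) ≤
      (prodBernoulli w).real {ω : BondConfig (Fin n) | ∀ x ∈ X, ¬ (openGraph ω).Reachable s x} *
        ∑ T : Finset (Fin n), (φ T * ψ T) *
          (prodBernoulli w).real ({ω : BondConfig (Fin n) | ∀ x ∈ X, ¬ (openGraph ω).Reachable s x} ∩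
            {ω : BondConfig (Fin n) | openCluster ω s = (T : Set (Fin n))}) := by
  have key := BHK2006_clusterConditionalPositiveAssociation_holds (Fin n) w s X
    (fun C => - φ (Finset.univ.filter fun v : Fin n => v = s ∨ ∃ e ∈ C, v ∈ e))
    (fun C => - ψ (Finset.univ.filter fun v : Fin n => v = s ∨ ∃ e ∈ C, v ∈ e))
    (fun C C' h => neg_le_neg (hφ (offObs_vertF_mono s h)))
    (fun C C' h => neg_le_neg (hψ (offObs_vertF_mono s h))) hs
  simp only [offObs_vertF_openEdgeCluster, integral_neg, neg_mul_neg] at key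
  rw [offObs_setIntegral_clusterFn w s φ, offObs_setIntegral_clusterFn w s ψ,
    offObs_setIntegral_clusterFn w s (fun T => φ T * ψ T)] at key
  exact key

/-- Registered sub-goal `stub_offObsFibreMarkov_k28` of crux stmt-CriticalPhenomena-4576 (siege k28, file 1/3): the
cluster Markov property `offObs_fibre_inter`, by name and signature. [folklore] -/
theorem stub_offObsFibreMarkov_k28 : ∀ (n : ℕ) (w : Sym2 (Fin n) → unitInterval) (s : Fin n) (T : Finset (Fin n)), s ∈ T → ∀ (E : Set (BondConfig (Fin n))), DeterminedBy E (↑(Finset.univ.filter fun e : Sym2 (Fin n) => ∀ v ∈ e, v ∉ T) : Set (Sym2 (Fin n))) → (prodBernoulli w).real ({ω : BondConfig (Fin n) | openCluster ω s = (T : Set (Fin n))} ∩ E) = (prodBernoulli w).real {ω : BondConfig (Fin n) | openCluster ω s = (T : Set (Fin n))} * (prodBernoulli w).real E :=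
  fun _ w s T hs E hE => offObs_fibre_inter w s T hs E hE

end OffObserverFibres

end

end Summit.CriticalPhenomena.PercolationContinuityZ3.Theorems
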